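import Literature.Probability.RandomPlanarGeometry.JordanBoundaryWinding
import Literature.Probability.RandomPlanarGeometry.AffineInterp
import HarnessLib

/-!
# Winding number of a closed polygon shadowed by a periodic loop; zero winding off a loop

Two elementary winding-number tools (`Literature.Probability.RandomPlanarGeometry.WindingNumber`)
used to locate points inside lattice polygons approximating a Jordan domain:

* `wind_polygonLoop_sub_eq_mul` — **Rouché for a shadowed polygon.** If the closed polygon
  through `p₀, …, p_{N-1}` comes with real parameters `T 0, …, T N`, `T N = T 0 + m`, such that
  each edge `[p_k, p_{k+1}]` is closer than `r` to `γ u` for all `u` between `T k` and `T (k+1)`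
  (precisely `‖p_k - γ u‖ + ‖p_{k+1} - p_k‖ < r` for `|u - T k| ≤ |T (k+1) - T k|`), where `γ` is
  a continuous `1`-periodic loop keeping distance `≥ r` from `z₀`, then
  `wind (polygon - z₀) = m · wind (γ - z₀)`.  The polygon is uniformly `< r`-close to the
  reparametrised loop `γ ∘ Λ`, `Λ = knotInterp T N` the piecewise-affine interpolation of the
  knots on the polygon's time grid, so Rouché (`wind_eq_of_norm_sub_lt`) and the degree formula
  `wind (γ ∘ Λ - z₀) = m · wind (γ - z₀)` (`wind_comp_eq_mul_of_periodic`,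
  `JordanBoundaryWinding`) conclude.
* `wind_sub_eq_zero_of_joined` — **a loop does not wind around points joined to infinity off
  the loop**: if `γ` takes values in a closed set `K`, `‖γ‖ ≤ M`, and `z ∉ K` is joined inside
  `Kᶜ` to a point of norm `> M`, then `wind (γ - z) = 0` (Eilenberg–Janiszewski logarithm of
  `(· - z)/(· - w)` on `K`, then Rouché against a constant loop).

[folklore]
-/

noncomputable section

open Set Function Complex Filter Metric
open _root_.Topology
open Literature.Topology.PlaneTopology

namespace Literature.Probability.RandomPlanarGeometry

/-- The piecewise-affine interpolation of the knots `T 0, …, T N` on the grid `k/N` of `[0, 1]`: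
`Λ t = affineInterp [T 0, …, T N] (N t)`. [folklore] -/
def knotInterp (T : ℕ → ℝ) (N : ℕ) (t : ℝ) : ℝ :=
  affineInterp (List.ofFn fun i : Fin (N + 1) => T i) (N * t)

/-- `knotInterp` is continuous. [folklore] -/
theorem continuous_knotInterp (T : ℕ → ℝ) (N : ℕ) : Continuous (knotInterp T N) :=
  (continuous_affineInterp _).comp (continuous_const.mul continuous_id)

/-- `knotInterp` at `0`. [folklore] -/
theorem knotInterp_zero (T : ℕ → ℝ) (N : ℕ) : knotInterp T N 0 = T 0 := by
  rw [knotInterp, mul_zero, show (0 : ℝ) = ((0 : ℕ) : ℝ) by simp, affineInterp_natCast _ 0 (by simp)]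
  simp only [List.getElem_ofFn]

/-- `knotInterp` at `1`. [folklore] -/
theorem knotInterp_one (T : ℕ → ℝ) (N : ℕ) : knotInterp T N 1 = T N := by
  rw [knotInterp, mul_one, affineInterp_natCast _ N (by simp)]
  simp only [List.getElem_ofFn]

/-- **On the piece `[k/N, (k+1)/N]` the interpolation stays within the knot increment**:
`|Λ t - T k| ≤ |T (k+1) - T k|`. [folklore] -/
theorem abs_knotInterp_sub_le (T : ℕ → ℝ) {N k : ℕ} (hk : k < N) {t : ℝ}
    (ht : (N : ℝ) * t ∈ Icc (k : ℝ) (k + 1)) : |knotInterp T N t - T k| ≤ |T (k + 1) - T k| := by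
  rw [knotInterp, affineInterp_eq_lineMap _ k (by simp; omega) ht]
  simp only [List.getElem_ofFn, AffineMap.lineMap_apply_module', smul_eq_mul]
  have h1 : (0 : ℝ) ≤ (N : ℝ) * t - k := by linarith [ht.1]
  have h2 : (N : ℝ) * t - k ≤ 1 := by linarith [ht.2]
  rw [add_sub_cancel_right, abs_mul, abs_of_nonneg h1]
  exact mul_le_of_le_one_left (abs_nonneg _) h2

/-- **Rouché for a closed polygon shadowed by a periodic loop.** Let `γ` be continuous,
`1`-periodic, with `‖γ u - z₀‖ ≥ r > 0` for all `u`; let the closed polygon through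
`l = [p₀, …, p_{N-1}]` come with parameters `T 0, …, T N`, `T N = T 0 + m` (`m ∈ ℤ`), such
that on each edge `‖p_k - γ u‖ + ‖p_{k+1} - p_k‖ < r` whenever `|u - T k| ≤ |T (k+1) - T k|`.
Then `wind (polygon - z₀) = m · wind (γ - z₀)`: the polygon is uniformly `< r`-close to the
reparametrised loop `γ ∘ Λ` (`Λ` the interpolation of the `T k` on the polygon's time grid),
whence the same winding number (Rouché, `wind_eq_of_norm_sub_lt`), and
`wind (γ ∘ Λ - z₀) = m · wind (γ - z₀)` (`wind_comp_eq_mul_of_periodic`). [folklore] -/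
theorem wind_polygonLoop_sub_eq_mul {l : List ℂ} (hl : l ≠ []) {γ : ℝ → ℂ} (hγ : Continuous γ)
    (hper : Function.Periodic γ 1) {z₀ : ℂ} {r : ℝ} (hr : 0 < r) (hz : ∀ u, r ≤ ‖γ u - z₀‖)
    (T : ℕ → ℝ) {m : ℤ} (hTN : T l.length = T 0 + m)
    (hclose : ∀ (k : ℕ) (hk : k < l.length) (u : ℝ), |u - T k| ≤ |T (k + 1) - T k| →
      ‖l[k] - γ u‖ + ‖(l[(k + 1) % l.length]'(Nat.mod_lt _ (by omega))) - l[k]‖ < r) :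
    wind (fun t => polygonLoop l t - z₀) = m * wind (fun t => γ t - z₀) := by
  set N := l.length with hN
  have hN0 : 0 < N := List.length_pos_iff.2 hl
  have hNr : (0 : ℝ) < N := by exact_mod_cast hN0
  set Λ := knotInterp T N with hΛ
  have hγ0 : ∀ u, γ u - z₀ ≠ 0 := fun u h => by
    have := hz u; rw [h, norm_zero] at this; exact not_lt.2 this hr
  -- Rouché: the polygon against `γ ∘ Λ`
  have hrouche : wind (fun t => polygonLoop l t - z₀) = wind (fun t => γ (Λ t) - z₀) := by
    have h01 : polygonLoop l 1 = polygonLoop l 0 := by simpa using (periodic_polygonLoop l) 0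
    refine wind_eq_of_norm_sub_lt ((continuous_polygonLoop l).continuousOn.sub continuousOn_const)
      (by show polygonLoop l 0 - z₀ = polygonLoop l 1 - z₀; rw [h01]) ?_ fun t ht => ?_
    · refine ⟨((hγ.comp (continuous_knotInterp T N)).continuousOn).sub continuousOn_const,
        fun t _ => hγ0 _, ?_⟩
      show γ (Λ 0) - z₀ = γ (Λ 1) - z₀
      rw [hΛ, knotInterp_zero, knotInterp_one, hTN,
        show T 0 + (m : ℝ) = T 0 + (m : ℤ) * (1 : ℝ) by ring, hper.int_mul m]
    · -- the piece containing `t`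
      obtain ⟨k, hk, θ, hθ, hkt, hpoly⟩ : ∃ (k : ℕ) (hk : k < N) (θ : ℝ), θ ∈ Icc (0 : ℝ) 1 ∧
          (k + θ) / N = t ∧ polygonLoop l t = AffineMap.lineMap l[k] (l[(k + 1) % N]'(Nat.mod_lt _ hN0)) θ := by
        rcases eq_or_lt_of_le ht.2 with rfl | hlt
        · refine ⟨N - 1, by omega, 1, ⟨zero_le_one, le_rfl⟩, ?_, ?_⟩
          · rw [Nat.cast_sub hN0]; field_simp; push_cast; ring
          · have := polygonLoop_apply_div (l := l) (k := N - 1) (by omega) (θ := 1) ⟨zero_le_one, le_rfl⟩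
            rw [show ((N - 1 : ℕ) : ℝ) + 1 = N by rw [Nat.cast_sub hN0]; push_cast; ring, div_self hNr.ne'] at this
            exact this
        · obtain ⟨k, hk, θ, hθ, hkt, hv⟩ := polygonLoop_eq_of_floor hl t
          rw [Int.fract_eq_self.2 ⟨ht.1, hlt⟩] at hkt
          exact ⟨k, hk, θ, ⟨hθ.1, hθ.2.le⟩, hkt, hv⟩
      have hNt : (N : ℝ) * t ∈ Icc (k : ℝ) (k + 1) := by
        rw [← hkt, mul_div_cancel₀ _ hNr.ne']
        exact ⟨by linarith [hθ.1], by linarith [hθ.2]⟩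
      have hΛk : |Λ t - T k| ≤ |T (k + 1) - T k| := abs_knotInterp_sub_le T hk hNt
      have hc := hclose k hk (Λ t) hΛk
      -- `‖P t - p_k‖ ≤ ‖p_{k+1} - p_k‖`
      have hP : ‖polygonLoop l t - l[k]‖ ≤ ‖(l[(k + 1) % N]'(Nat.mod_lt _ hN0)) - l[k]‖ := by
        rw [hpoly, AffineMap.lineMap_apply_module']
        rw [show θ • ((l[(k + 1) % N]'(Nat.mod_lt _ hN0)) - l[k]) + l[k] - l[k] =
          θ • ((l[(k + 1) % N]'(Nat.mod_lt _ hN0)) - l[k]) by abel, norm_smul, Real.norm_of_nonneg hθ.1]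
        exact mul_le_of_le_one_left (norm_nonneg _) hθ.2
      calc ‖polygonLoop l t - z₀ - (γ (Λ t) - z₀)‖ = ‖(polygonLoop l t - l[k]) + (l[k] - γ (Λ t))‖ := by
            congr 1; abel
        _ ≤ ‖polygonLoop l t - l[k]‖ + ‖l[k] - γ (Λ t)‖ := norm_add_le _ _
        _ < r := by linarith
        _ ≤ ‖γ (Λ t) - z₀‖ := hz _
  rw [hrouche]
  -- degree of the reparametrised loop
  have := wind_comp_eq_mul_of_periodic (g := fun u => γ u - z₀) (hγ.sub continuous_const)
    (fun u => by simp only [hper u]) hγ0 (Λ := Λ) (continuous_knotInterp T N).continuousOn (m := m)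
    (by rw [hΛ, knotInterp_one, knotInterp_zero, hTN])
  exact this


/-! ### A loop does not wind around points joined to infinity off the loop -/

/-- **Zero winding about a point joined to far away.** Let `γ` be a loop on `[0, 1]` with values
in a closed set `K` and `‖γ‖ ≤ M`; if `z ∉ K` is joined inside `Kᶜ` to a point `w` with
`M < ‖w‖`, then `wind (γ - z) = 0`: by the Eilenberg–Janiszewski logarithm of `(· - z)/(· - w)`
on `K`, `wind (γ - z) = wind (γ - w)`, and the latter vanishes by Rouché against the constant
loop `-w`. [folklore] -/
theorem wind_sub_eq_zero_of_joined {γ : ℝ → ℂ} (hγ : ContinuousOn γ (Icc 0 1)) (h01 : γ 0 = γ 1)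
    {K : Set ℂ} (hK : IsClosed K) (hγK : MapsTo γ (Icc 0 1) K) {M : ℝ}
    (hM : ∀ t ∈ Icc (0 : ℝ) 1, ‖γ t‖ ≤ M) {z w : ℂ} (hz : z ∉ K)
    (hw : w ∈ connectedComponentIn Kᶜ z) (hwM : M < ‖w‖) : wind (fun t => γ t - z) = 0 := by
  have hwK : w ∉ K := connectedComponentIn_subset _ _ hw
  have hM0 : 0 ≤ M := (norm_nonneg _).trans (hM 0 ⟨le_rfl, zero_le_one⟩)
  have hw0 : w ≠ 0 := by
    rintro rfl
    rw [norm_zero] at hwM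
    exact not_lt.2 hM0 hwM
  have hlog := hasLogOn_div_sub_of_mem_connectedComponentIn hK hw
  have hf : IsNonvanishingLoop fun t => γ t - z :=
    ⟨hγ.sub continuousOn_const, fun t ht h => hz (sub_eq_zero.1 h ▸ hγK ht), by simp only [h01]⟩
  have hg : IsNonvanishingLoop fun t => γ t - w :=
    ⟨hγ.sub continuousOn_const, fun t ht h => hwK (sub_eq_zero.1 h ▸ hγK ht), by simp only [h01]⟩
  have h1 : wind ((fun x => (x - z) / (x - w)) ∘ γ) = 0 :=
    wind_comp_eq_zero_of_hasLogOn hlog hγ hγK h01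
  have h2 : wind (fun t => γ t - z) = wind (fun t => γ t - w) := by
    have h3 := wind_div hf hg
    have h1' : wind (fun t => (γ t - z) / (γ t - w)) = 0 := h1
    change wind (fun t => (γ t - z) / (γ t - w)) = _ at h3
    omega
  have h3 : wind (fun t => γ t - w) = 0 := by
    rw [← wind_const (-w)]
    refine wind_eq_of_norm_sub_lt hg.continuousOn hg.eq_endpoints
      (IsNonvanishingLoop.const (neg_ne_zero.2 hw0)) fun t ht => ?_
    simpa using (hM t ht).trans_lt hwM
  exact h2.trans h3

/-- **A point about which a loop winds lies in a bounded complementary component.** [folklore] -/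
theorem isBounded_connectedComponentIn_of_wind_ne_zero {γ : ℝ → ℂ} (hγ : ContinuousOn γ (Icc 0 1))
    (h01 : γ 0 = γ 1) {K : Set ℂ} (hK : IsClosed K) (hγK : MapsTo γ (Icc 0 1) K) {z : ℂ}
    (hz : z ∉ K) (hw : wind (fun t => γ t - z) ≠ 0) :
    Bornology.IsBounded (connectedComponentIn Kᶜ z) := by
  obtain ⟨M, hM⟩ := (isCompact_Icc.image_of_continuousOn hγ).isBounded.exists_norm_le
  by_contra hunb
  obtain ⟨w, hw', hwM⟩ : ∃ w ∈ connectedComponentIn Kᶜ z, M < ‖w‖ := by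
    by_contra h
    push Not at h
    exact hunb ((Metric.isBounded_closedBall (x := (0 : ℂ)) (r := M)).subset fun w hw'' => by
      simpa using h w hw'')
  exact hw (wind_sub_eq_zero_of_joined hγ h01 hK hγK (fun t ht => hM _ ⟨t, ht, rfl⟩) hz hw' hwM)

end Literature.Probability.RandomPlanarGeometry
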